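import Summits.ResolutionOfSingularities.ResolutionOfSingularities.Theorems.UniversalCellsCampaignW82ClimbKernelGraded
import Literature.AlgebraicGeometry.Resolution.ResolutionOfCurves
import HarnessLib

/-!
# [OURS · L1 W8.2] Rungs of the dimension-graded climb kernel `CampaignW82.ClimbRatFuncPerfDimLe`

Cell `res-hironaka` (run/shared/lean/pub/res-hironaka/), LADDER-RESOLUTION rung L (RESCUE), slot W8.2 of
plan/RESCUE-SEED.md («PRIME-FIELD / UNIVERSALITY TRANSFER instead of descent»), host route `UniversalCells`,
host item `PrimeFieldToPerfect` (stmt-ResolutionOfSingularities-15233). Prover res-L1-s82-pv-1. THESES-FREE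
module (imports the Theses-free OURS vocabulary file `…CampaignW82ClimbKernelGraded` (p466046), the tree's
resolution of curves, and `HarnessLib`; cell build rule (B)).

The OURS `Prop` `CampaignW82.ClimbRatFuncPerfDimLe p m n` (typer res-L1-type-o6) is the climb kernel of slot
W8.2 — resolution over a PERFECT `M` of characteristic `p` in dimension `≤ m` ⇒ resolution over every PERFECT
`L` purely inseparable over `RatFunc M` in dimension `≤ n` — graded by dimension. This file records, sorry-free,
the rungs that hold NOW:

* `climbRatFuncPerfDimLe_of_le_one` — **`n ≤ 1`, every `m`, UNCONDITIONALLY**: an integral scheme of finite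
  type over the field `L` of dimension `≤ 1` is a reduced curve, resolved by (a finite sequence of)
  normalisations (`Literature.AlgebraicGeometry.Resolution.hasResolution_of_dim_le_one`, proved in tree); the
  hypothesis on `M` is not used.
* `climbRatFuncPerfDimLe_bot`, `climbRatFuncPerfDimLe_zero` — the degenerate grades `n = ⊥`, `n = 0`.
* `climbRatFuncPerfDimLe_of_le_three` — **`n ≤ 3`, every `m`, CONDITIONAL on the named fact F-02**
  `Literature.AlgebraicGeometry.Resolution.CossartPiltant2019` (plan/FACT-LIST.md §A; Cossart–Piltant 2019,
  Thm. 1.1: reduced separated schemes of finite type of dimension `≤ 3` over any field), taken as a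
  hypothesis `(hCP : CossartPiltant2019)` — a conditional result; the hypothesis on `M` is again unused.

So the first grade of the kernel with content is `n = 4` (hypothesis side `m = ⊤`, or `m = 5` through a
family over a curve over `M`), as recorded in p466046's docstring and L/res-L1-k82/KILL-TEST-K8.2.md §4.

HONEST FRAMING. OURS bookkeeping about an OURS statement; NOT a statement of H. Hironaka's 2017 manuscript
(*Resolution of singularities in positive characteristics*, [Hironaka2017]); nothing here is attributed to
its author; no typed candidate of the manuscript is used, even as a hypothesis. The rungs `n ≤ 3` say nothing
about the open range (dimension `≥ 4`). AI work, weaker than expert review.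

## References (vocabulary and locators only)
* V. Cossart, O. Piltant, *Resolution of singularities of arithmetical threefolds*, J. Algebra 529 (2019),
  Thm. 1.1 — the named fact F-02 (hypothesis of the conditional rung). [CossartPiltant2019]
* R. Hartshorne, *Algebraic Geometry* (1977), Ch. V Rem. 3.8.1 (curves: normalisation resolves) — behind the
  tree theorem `hasResolution_of_dim_le_one`. [Hartshorne1977]
* plan/RESCUE-SEED.md row W8.2; L/res-L1-k82/KILL-TEST-K8.2.md §4; res-L1-type-o6 INBOX 2026-08-26T20:23:09Z.
-/

noncomputable section

set_option linter.dupNamespace false -- mandated namespace of this single-conjunct summit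

open _root_.CategoryTheory _root_.AlgebraicGeometry
open Literature.AlgebraicGeometry.Resolution

namespace Summit.ResolutionOfSingularities.ResolutionOfSingularities.Theorems.CampaignW82

/-- **Rung `n ≤ 1` of the graded climb kernel, unconditional**: for every `p`, `m` and every `n ≤ 1`,
`ClimbRatFuncPerfDimLe p m n` holds — an integral scheme of finite type over a field, of dimension `≤ 1`,
is a reduced curve and has a resolution (`hasResolution_of_dim_le_one`); the resolution hypothesis over
`M` is not used. [folklore] -/
theorem climbRatFuncPerfDimLe_of_le_one (p : ℕ) (m n : WithBot ℕ∞) (hn : n ≤ 1) :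
    ClimbRatFuncPerfDimLe p m n := by
  intro M _ _ _ _ L _ _ _ _ X f _ hl hq hX hd
  haveI := hl
  haveI := hq
  exact hasResolution_of_dim_le_one X f (hd.trans hn)

/-- The degenerate grade `n = ⊥` (no integral scheme has dimension `≤ ⊥`; in any case covered by the curve
rung). [folklore] -/
theorem climbRatFuncPerfDimLe_bot (p : ℕ) (m : WithBot ℕ∞) : ClimbRatFuncPerfDimLe p m ⊥ :=
  climbRatFuncPerfDimLe_of_le_one p m ⊥ bot_le

/-- The grade `n = 0` (points), a special case of the curve rung. [folklore] -/
theorem climbRatFuncPerfDimLe_zero (p : ℕ) (m : WithBot ℕ∞) : ClimbRatFuncPerfDimLe p m 0 :=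
  climbRatFuncPerfDimLe_of_le_one p m 0 (by decide)

/-- The grade `n = 1` (curves). [folklore] -/
theorem climbRatFuncPerfDimLe_one (p : ℕ) (m : WithBot ℕ∞) : ClimbRatFuncPerfDimLe p m 1 :=
  climbRatFuncPerfDimLe_of_le_one p m 1 le_rfl

/-- **Rung `n ≤ 3` of the graded climb kernel, conditional on the named fact F-02
`CossartPiltant2019`** (Cossart–Piltant 2019, Thm. 1.1, vendored as a `Prop` and taken here as the
hypothesis `hCP`): for every `p`, `m` and `n ≤ 3`, `ClimbRatFuncPerfDimLe p m n` — an integral scheme of finite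
type over the field `L` is reduced, separated by assumption and of dimension `≤ 3`, so F-02 resolves it; the
resolution hypothesis over `M` is not used. Conditional result (F-02 is not proved in the tree).
[cite: CossartPiltant2019, Thm. 1.1] -/
theorem climbRatFuncPerfDimLe_of_le_three (hCP : CossartPiltant2019.{0}) (p : ℕ) (m n : WithBot ℕ∞)
    (hn : n ≤ 3) : ClimbRatFuncPerfDimLe p m n := by
  intro M _ _ _ _ L _ _ _ _ X f hs hl hq hX hd
  exact hCP L X f hs hl hq inferInstance (hd.trans hn)

/-- Under F-02, every grade `(m, n)` with `n ≤ 3` — in particular `(⊤, 3)`, the weakest grade with conclusion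
bound `3` (`climbRatFuncPerfDimLe_mono`). [cite: CossartPiltant2019, Thm. 1.1] -/
theorem climbRatFuncPerfDimLe_top_three (hCP : CossartPiltant2019.{0}) (p : ℕ) :
    ClimbRatFuncPerfDimLe p ⊤ 3 :=
  climbRatFuncPerfDimLe_of_le_three hCP p ⊤ 3 le_rfl

end Summit.ResolutionOfSingularities.ResolutionOfSingularities.Theorems.CampaignW82

end
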